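import Summits.ABC.Harvest.ShimuraDegree
import Summits.ABC.Harvest.OpenQuestions
import Summits.ABC.Analytic.PolySzpiro
import Literature.NumberTheory.Automorphic.ShimuraCurveRibetTakahashiLogFormProofs
import Literature.NumberTheory.Automorphic.ShimuraCurveRibetTakahashiNumeratorProofs
import Literature.NumberTheory.Automorphic.ShimuraParametrizationSplitDegreeProofs
import Literature.NumberTheory.Automorphic.ShimuraCurveDataExistence
import Literature.NumberTheory.EllipticCurves.IsogenyVariableChangeProofs
import Literature.NumberTheory.EllipticCurves.IsogenyCompProofs
import Literature.NumberTheory.EllipticCurves.CuspFormLFunctionLevelConductorProofs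
import Literature.NumberTheory.EllipticCurves.ModularParametrizationBCDTProofs
import Literature.NumberTheory.EllipticCurves.PastenHeightBoundsClassicalInputProofs
import Literature.NumberTheory.EllipticCurves.PastenValuationProductThm75Proofs
import Literature.NumberTheory.DiophantineGeometry.AbcWave0BakerExplicitProofs
import Literature.NumberTheory.DiophantineGeometry.FaltingsHeightProofs
import Literature.NumberTheory.DiophantineGeometry.MinimalDiscriminantRingOfIntegersProofs
import HarnessLib

/-!
# ABC harvest 2015–2026: the Shimura-degree door reaches polynomial Szpiro (glue G-09, explicit constants)

`Summits/ABC/Harvest/GlueShimura.lean` — cell `abc-harv` (C3), seat `abc-harv-typ-1` (KEY G09-SHIMURA), namespace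
`Summit.ABC.Harvest`. PROOF-ONLY file (no definition, no `sorry`, no axiom, no Literature fact): §GLUE LEDGER **G-09** of
the cell's table of record — the TYPED Shimura-degree door `Summit.ABC.Harvest.ShimuraDegreeConjecture`
(`Summits/ABC/Harvest/ShimuraDegree.lean`; Pasten, J. Number Theory 254 (2024), Thm 1.7 = Thm 7.6 and §1.4: "`δ_{D,M}(E)`
bounded polynomially on the conductor for one admissible factorisation `N_E = D·M` per curve"; row H-020, census C3 = desk
O-66) ⟹ the sub-summit rung **A-PS** `Summit.ABC.PolySzpiroRat` / `Summit.ABC.PolySzpiroRatEff K C`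
(`Summits/ABC/Analytic/PolySzpiro.lean`), for ALL elliptic curves over `ℚ`, with EVERY constant explicit, MODULO THREE NAMED
printed theorems (displayed hypotheses, none silent):

* `h61` = Pasten's refined Ribet–Takahashi formula, Thm 6.1 (numerator of `γ_{D,M,E}` at most `163^{ω(D)}`):
  `Literature.NumberTheory.Automorphic.PastenShimura2024_thm_6_1`, consumed through its tree-PROVED printed form (EqUpperRT)
  `PastenShimura2024_thm_6_1.log_le`: `log δ_{1,N} ≤ log δ_{D,M} + log ∏_{p∣D} v_p(Δ_E) + 5.1·ω(D)`;
* `hmod` = modularity with an integral Manin constant (`ModularForms.nonempty_modularParametrizationData`; Wiles,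
  Taylor–Wiles, BCDT + Edixhoven);
* `h163` = Mazur–Kenku (`ModularForms.PastenShimura2024_minimalDegree_le_163_mul`).

Chain = Pasten's proof of Thm 7.6 (§7.5 p. 27: "The classical modular approach gives upper bounds for `h(E)` and
`log|Δ_E|` in terms of `log δ_{1,N}` (cf. (3.2) and (3.4)). The result now follows from the first (effective) inequality in
Theorem 6.1, together with the estimates `log ∏_{p∣D} v_p(Δ_E) ≤ log d(Δ_E) < 1.07 log|Δ_E|/log log|Δ_E| …`") over
tree-PROVED inputs: (EqHDeg) `h(E) ≤ ½ log δ_{1,N} + 9` at the class-minimal datum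
(`pasten2024_eq_3_4_classMinimal_of_modularity_of_mazurKenku`, mod `hmod`, `h163`), (EqDiscH) `log|Δ_min| < 12 h_F + 16`
(`WeierstrassCurve.log_minimalDiscriminantNorm_lt_faltingsHeight_holds`), (EqUpperRT) (mod `h61`), and — in place of the
divisor bound — the EXPLICIT bootstrap `log ∏_{p∣D} v_p(Δ_E) ≤ ω(D)·log(X/log 2) ≤ X/42 + log ω(D)! + ω(D)·log(42/log 2)`,
`ω(D)! ≤ D ≤ N_E`, `ω(D)·log 2 ≤ log N_E`, `log(42/log 2) ≤ 4.2` (`X = log|Δ_min(E)|`; `v_p(Δ_E) ≤ X/log 2` as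
`p^{v_p} ∣ Δ_min`; `(θt)^k/k! ≤ e^{θt}`, Mathlib `Real.pow_div_factorial_le_exp`; tree `card_factorial_le_prod`), which
absorbs the factor `∏_{p∣D} v_p(Δ_E)` of display (6.1) into `X/7 + O(log N_E)` — NO «polynomial Tamagawa bound» hypothesis
(the cell's §GLUE LEDGER listed one). Result, per curve (`log_minimalDiscriminant_le_of_shimuraDegree_le`):
`log δ_{D,M}(E) ≤ B ⟹ log|Δ_min(E)| ≤ 7B + 101·log N_E + 145` and `h_F(E) ≤ (7/12)B + 8.5·log N_E + 11`; with
`B = K log N_E + C`: `polySzpiroRatEff_of_log_shimuraDegree_le : … → Summit.ABC.PolySzpiroRatEff (7K + 101) (7C + 145)`,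
`faltingsHeight_le_of_log_shimuraDegree_le`, `heightConjecture_of_shimuraDegreeConjecture` and
**`polySzpiroRat_of_shimuraDegreeConjecture`** (G-09). Pasten's asymptotic exponent is `(6 + ε)K` (Thm 7.6, via
`d(n) ≤ n^{1.07/log log n}`); the explicit `7K + 101` trades the `ε` for constants valid for EVERY `E/ℚ` (no `N ≫_ε 1`).
Also here: `shimuraDegreeConjecture_of_modularDegreeConjecture` — the `D = 1` door (`ModularDegreeConjecture`, Conj. 3.2)
is the `(1, N)`-instance, PROVED modulo `hmod` alone (level-`(1, N)` data exist as a THEOREM, `nonempty_shimuraCurveData_holds`;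
split-case transport with the degree, `exists_shimuraParametrizationData_deg_eq_modularDegree`), so
`ModularDegreeConjecture ⟹ ShimuraDegreeConjecture ⟹ HeightConjecture ⟹ A-PS`. NOT here: a converse (none known: A-PS ⟹
Height is open, ENGINE C3 (iii)); the `D = 1` door's sharper constants (`6K`, `GlueModular.lean`, seat pr-1); Thm 7.6 in
`ε`-form over abstract degree functions (tree `ModularForms.pasten2024_thm_7_6_height_of_bounds`).

HONESTY LINE (D-0139/D-0140): abc is not proved by any of this; A-PS is NOT abc — «NOT abc — POLY-SZPIRO(7K + 101)»;
PROVED-MOD-FACTS ≠ proved; typed ≠ proved; the conjecture is a hypothesis, never asserted.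
-/

noncomputable section

namespace Summit.ABC.Harvest

open WeierstrassCurve
open Literature.NumberTheory.EllipticCurves
open Literature.NumberTheory.EllipticCurves.ModularForms
open Literature.NumberTheory.DiophantineGeometry (card_factorial_le_prod)
open Literature.NumberTheory.Automorphic
open scoped Nat

/-! ## Elementary inputs of the bootstrap -/

/-- `k·log t ≤ θt + log k! + k·log(1/θ)` for `t ≥ 0`, `0 < θ ≤ 1` and every `k : ℕ` — the logarithm of one term of the
exponential series, `(θt)^k/k! ≤ e^{θt}` (Mathlib `Real.pow_div_factorial_le_exp`). [folklore] -/
theorem natCast_mul_log_le_of_pow_div_factorial (k : ℕ) {t θ : ℝ} (ht : 0 ≤ t) (hθ : 0 < θ) (hθ1 : θ ≤ 1) :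
    (k : ℝ) * Real.log t ≤ θ * t + Real.log (k ! : ℝ) + k * Real.log (1 / θ) := by
  have hfac : (0 : ℝ) < k ! := by positivity
  have hfac1 : (1 : ℝ) ≤ k ! := by exact_mod_cast Nat.one_le_of_lt (Nat.factorial_pos k)
  have hlogfac : 0 ≤ Real.log (k ! : ℝ) := Real.log_nonneg hfac1
  have hlog1θ : 0 ≤ Real.log (1 / θ) := Real.log_nonneg (by rw [le_div_iff₀ hθ]; linarith)
  rcases ht.eq_or_lt with h0 | ht'
  · rw [← h0, Real.log_zero, mul_zero, mul_zero, zero_add]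
    positivity
  · have h := Real.pow_div_factorial_le_exp (θ * t) (by positivity) k
    have h2 : Real.log ((θ * t) ^ k / k !) ≤ θ * t := by
      have := Real.log_le_log (by positivity) h
      rwa [Real.log_exp] at this
    rw [Real.log_div (by positivity) hfac.ne', Real.log_pow, Real.log_mul hθ.ne' ht'.ne'] at h2
    have h3 : (k : ℝ) * (Real.log θ + Real.log t) = k * Real.log θ + k * Real.log t := by ring
    rw [one_div, Real.log_inv]
    linarith

/-- `log(42/log 2) ≤ 4.2`: `42/log 2 ≤ 61` (`log 2 > 0.6931`) and `61 ≤ e^{4.2} = (e^1)^4·e^{0.2} ≥ 2.718^4·1.2`.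
[folklore] -/
theorem log_div_log_two_le : Real.log (42 / Real.log 2) ≤ 4.2 := by
  have h2 : (0.6931471803 : ℝ) < Real.log 2 := Real.log_two_gt_d9
  have hl2 : 0 < Real.log 2 := by linarith
  have hpos : 0 < 42 / Real.log 2 := by positivity
  have h61 : 42 / Real.log 2 ≤ 61 := by rw [div_le_iff₀ hl2]; linarith
  calc Real.log (42 / Real.log 2) ≤ Real.log 61 := Real.log_le_log hpos h61
    _ ≤ 4.2 := by
      rw [Real.log_le_iff_le_exp (by norm_num)]
      have h1 : (2.7182818283 : ℝ) < Real.exp 1 := Real.exp_one_gt_d9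
      have h4 : (2.7182818283 : ℝ) ^ 4 ≤ Real.exp 4 := by
        have : Real.exp 4 = Real.exp 1 ^ 4 := by rw [← Real.exp_nat_mul]; norm_num
        rw [this]
        exact pow_le_pow_left₀ (by norm_num) h1.le 4
      have h02 : (0.2 : ℝ) + 1 ≤ Real.exp 0.2 := Real.add_one_le_exp _
      have hsplit : Real.exp 4.2 = Real.exp 4 * Real.exp 0.2 := by rw [← Real.exp_add]; norm_num
      rw [hsplit]
      calc (61 : ℝ) ≤ (2.7182818283 : ℝ) ^ 4 * (0.2 + 1) := by norm_num
        _ ≤ Real.exp 4 * Real.exp 0.2 := mul_le_mul h4 h02 (by norm_num) (Real.exp_pos _).le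

/-- `v_p(n) ≤ log n / log 2` for a prime `p` and `n ≥ 1` (`p^{v_p(n)} ∣ n`, `p ≥ 2`). [folklore] -/
theorem natCast_factorization_le_log_div_log_two {n p : ℕ} (hn : 0 < n) (hp : p.Prime) :
    (n.factorization p : ℝ) ≤ Real.log n / Real.log 2 := by
  have hdvd : p ^ n.factorization p ∣ n := Nat.ordProj_dvd n p
  have hle : p ^ n.factorization p ≤ n := Nat.le_of_dvd hn hdvd
  have hp2 : (2 : ℝ) ≤ p := by exact_mod_cast hp.two_le
  have hl2 : 0 < Real.log 2 := Real.log_pos one_lt_two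
  have hlogp : Real.log 2 ≤ Real.log p := Real.log_le_log two_pos hp2
  have hreal : (p : ℝ) ^ n.factorization p ≤ n := by exact_mod_cast hle
  have hlog := Real.log_le_log (by positivity) hreal
  rw [Real.log_pow] at hlog
  have hn0 : 0 ≤ Real.log n := Real.log_natCast_nonneg n
  rw [le_div_iff₀ hl2]
  calc (n.factorization p : ℝ) * Real.log 2 ≤ n.factorization p * Real.log p := by gcongr
    _ ≤ Real.log n := hlog

/-! ## The chain for a globally minimal model -/

/-- **The chain of the proof of Thm 7.6 with explicit constants, for ONE curve.** Let `W` be a global minimal model of an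
elliptic curve `E/ℚ` of conductor `N`, `N = D·M` admissible, `X` a Shimura curve datum of level `(D, M)` and `P` a
parametrisation datum on `X` realising `δ_{D,M}(E)` (`P.IsMinimalFor W`) with `log P.deg ≤ B`. Then
`log|Δ_min(E)| ≤ 7B + 101·log N + 145` and `h_F(E) ≤ (7/12)B + 8.5·log N + 11`. Hypotheses: `h61` (Pasten Thm 6.1 =
refined Ribet–Takahashi), `hmod` (modularity), `h163` (Mazur–Kenku). Steps: a datum `D'` of `W` (`hmod`), a class-minimal
datum `D₀` with the same newform (`Pasten2024.exists_minimal_datum_in_class`); (EqUpperRT) at `(D₀, P)`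
(`PastenShimura2024_thm_6_1.log_le h61`); (EqHDeg) `h(D'.L) ≤ ½ log D₀.deg + 9`
(`pasten2024_eq_3_4_classMinimal_of_modularity_of_mazurKenku hmod h163`) and `h_F(W) = h(D'.L)`; (EqDiscH)
`log|Δ_min| < 12 h_F + 16`; the bootstrap of the module docstring for `∏_{p∣D} v_p(Δ_min)` (`p ∣ D ∣ N ∣ Δ_min`, so every
factor is `≥ 1` and `≤ log|Δ_min|/log 2`; `ω(D)! ≤ D ≤ N`, `2^{ω(D)} ≤ D`). «NOT abc — POLY-SZPIRO(E)» downstream.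
[cite: PastenShimura2024, Thm. 7.6 (proof, §7.5 p. 27), Thm. 6.1 (p. 20), §3 (3.2)/(3.4) (p. 13)] -/
theorem log_minimalDiscriminant_le_of_shimuraDegree_le
    (h61 : PastenShimura2024_thm_6_1) (hmod : nonempty_modularParametrizationData)
    (h163 : PastenShimura2024_minimalDegree_le_163_mul)
    (W : WeierstrassCurve ℚ) [W.IsElliptic] [W.IsGloballyMinimal]
    {D M : ℕ} (hadm : IsAdmissibleFactorization (W.conductorNorm ℤ) D M) (X : ShimuraCurveData D M)
    {W' : WeierstrassCurve ℚ} [W'.IsElliptic] (P : ShimuraParametrizationData X W') (hP : P.IsMinimalFor W)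
    {B : ℝ} (hdeg : Real.log (P.deg : ℝ) ≤ B) :
    Real.log (W.minimalDiscriminantNorm ℤ : ℝ) ≤ 7 * B + 101 * Real.log (W.conductorNorm ℤ : ℝ) + 145 ∧
      W.faltingsHeight ≤ 7 / 12 * B + 17 / 2 * Real.log (W.conductorNorm ℤ : ℝ) + 11 := by
  classical
  haveI : NeZero (W.conductorNorm ℤ) := ⟨(conductorNorm_pos_holds W).ne'⟩
  have hNpos : 0 < W.conductorNorm ℤ := conductorNorm_pos_holds W
  have hΔpos : 0 < W.minimalDiscriminantNorm ℤ := minimalDiscriminantNorm_pos_holds W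
  -- a datum of `W`, and a class-minimal datum `D₀` with the same newform
  obtain ⟨D'⟩ := hmod W
  obtain ⟨W₀, _, D₀, hf, hmin⟩ := Pasten2024.exists_minimal_datum_in_class D'
  have hnew : IsNewformOf W D₀.f := by rw [hf]; exact D'.isNewformOf
  -- (EqUpperRT) `log δ_{1,N} ≤ log δ_{D,M} + log ∏ v_p + 5.1 ω(D)`
  have hRT := PastenShimura2024_thm_6_1.log_le h61 hadm X W rfl W₀ D₀ hnew hmin W' P hP
  -- (EqHDeg) at the class-minimal datum and `h_F = h(D'.L)`
  have h34 := pasten2024_eq_3_4_classMinimal_of_modularity_of_mazurKenku hmod h163 W D'.L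
    D'.isNeronLattice D₀ hnew hmin
  have hheight : W.faltingsHeight = neronLatticeHeight D'.L := by
    rw [D'.faltingsHeight_eq, neronLatticeHeight]
  -- (EqDiscH) `log|Δ_min| < 12 h_F + 16`
  have hdisc := WeierstrassCurve.log_minimalDiscriminantNorm_lt_faltingsHeight_holds W
  rw [WeierstrassCurve.minimalDiscriminantNorm_ringOfIntegers_rat_holds W, Module.finrank_self,
    Nat.cast_one, inv_one, one_mul] at hdisc
  -- the bootstrap for `Pv = ∏_{p ∣ D} v_p(Δ_min)`
  set X : ℝ := Real.log (W.minimalDiscriminantNorm ℤ : ℝ) with hXdef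
  set Pv : ℕ := ∏ p ∈ D.primeFactors, (W.minimalDiscriminantNorm ℤ).factorization p with hPvdef
  have hX0 : 0 ≤ X := Real.log_natCast_nonneg _
  have hl2 : (0.6931471803 : ℝ) < Real.log 2 := Real.log_two_gt_d9
  have hl2' : Real.log 2 < 0.6931471808 := Real.log_two_lt_d9
  have hl2pos : 0 < Real.log 2 := by linarith
  have hDN : D ∣ W.conductorNorm ℤ := Dvd.intro M hadm.mul_eq
  have hNΔ : W.conductorNorm ℤ ∣ W.minimalDiscriminantNorm ℤ :=
    WeierstrassCurve.conductorNorm_dvd_minimalDiscriminantNorm W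
      (WeierstrassCurve.finite_setOf_ordMinimalDiscriminant_ne_zero_holds W)
  have hv1 : ∀ p ∈ D.primeFactors, 1 ≤ (W.minimalDiscriminantNorm ℤ).factorization p := fun p hp =>
    (Nat.prime_of_mem_primeFactors hp).factorization_pos_of_dvd hΔpos.ne'
      ((Nat.dvd_of_mem_primeFactors hp).trans (hDN.trans hNΔ))
  have hvle : ∀ p ∈ D.primeFactors,
      (((W.minimalDiscriminantNorm ℤ).factorization p : ℕ) : ℝ) ≤ X / Real.log 2 := fun p hp =>
    natCast_factorization_le_log_div_log_two hΔpos (Nat.prime_of_mem_primeFactors hp)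
  have hPv1 : 1 ≤ Pv := Finset.one_le_prod' fun p hp => hv1 p hp
  have hPvR : (1 : ℝ) ≤ Pv := by exact_mod_cast hPv1
  have hPvle : (Pv : ℝ) ≤ (X / Real.log 2) ^ D.primeFactors.card := by
    rw [hPvdef, Nat.cast_prod, ← Finset.prod_const]
    exact Finset.prod_le_prod (fun p _ => Nat.cast_nonneg _) hvle
  have hlogPv : Real.log (Pv : ℝ) ≤ D.primeFactors.card * Real.log (X / Real.log 2) := by
    rw [← Real.log_pow]
    exact Real.log_le_log (by linarith) hPvle
  -- `k log t ≤ X/42 + log k! + k log(42/log 2)`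
  have hkt := natCast_mul_log_le_of_pow_div_factorial D.primeFactors.card
    (t := X / Real.log 2) (θ := Real.log 2 / 42) (by positivity) (by positivity) (by linarith)
  have hθt : Real.log 2 / 42 * (X / Real.log 2) = X / 42 := by field_simp
  have hθinv : (1 : ℝ) / (Real.log 2 / 42) = 42 / Real.log 2 := by rw [one_div, inv_div]
  rw [hθt, hθinv] at hkt
  -- `k! ≤ D ≤ N` and `2^k ≤ D ≤ N`
  have hprodD : ∏ p ∈ D.primeFactors, p = D := Nat.prod_primeFactors_of_squarefree hadm.squarefree
  have hDle : D ≤ W.conductorNorm ℤ := Nat.le_of_dvd hNpos hDN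
  have hfacN : (D.primeFactors.card)! ≤ W.conductorNorm ℤ := by
    calc (D.primeFactors.card)! ≤ ∏ p ∈ D.primeFactors, p :=
          card_factorial_le_prod _ fun p hp => (Nat.prime_of_mem_primeFactors hp).one_le
      _ = D := hprodD
      _ ≤ _ := hDle
  have hpowN : 2 ^ D.primeFactors.card ≤ W.conductorNorm ℤ := by
    calc 2 ^ D.primeFactors.card ≤ ∏ p ∈ D.primeFactors, p :=
          Finset.pow_card_le_prod _ (fun p => p) 2 fun p hp => (Nat.prime_of_mem_primeFactors hp).two_le
      _ = D := hprodD
      _ ≤ _ := hDle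
  have hNR : (0 : ℝ) < (W.conductorNorm ℤ : ℝ) := by exact_mod_cast hNpos
  have hlogfac : Real.log ((D.primeFactors.card)! : ℝ) ≤ Real.log (W.conductorNorm ℤ : ℝ) :=
    Real.log_le_log (by positivity) (by exact_mod_cast hfacN)
  have hklog2 : (D.primeFactors.card : ℝ) * Real.log 2 ≤ Real.log (W.conductorNorm ℤ : ℝ) := by
    have h := Real.log_le_log (by positivity) (show ((2 : ℝ) ^ D.primeFactors.card) ≤ (W.conductorNorm ℤ : ℝ) by
      exact_mod_cast hpowN)
    rwa [Real.log_pow] at h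
  have hk0 : (0 : ℝ) ≤ D.primeFactors.card := Nat.cast_nonneg _
  have hk : (D.primeFactors.card : ℝ) * 0.6931471803 ≤ Real.log (W.conductorNorm ℤ : ℝ) := by nlinarith
  have hkL : (D.primeFactors.card : ℝ) * Real.log (42 / Real.log 2) ≤ D.primeFactors.card * 4.2 :=
    mul_le_mul_of_nonneg_left log_div_log_two_le hk0
  have hlN : 0 ≤ Real.log (W.conductorNorm ℤ : ℝ) := Real.log_natCast_nonneg _
  -- assemble
  rw [hheight] at hdisc ⊢
  have hX : X ≤ 7 * B + 101 * Real.log (W.conductorNorm ℤ : ℝ) + 145 := by linarith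
  exact ⟨hX, by linarith⟩

/-! ## The door with explicit constants: A-PS-eff and the Height conjecture -/

/-- **EFFECTIVE GLUE (PROVED MODULO THREE NAMED FACTS): a polynomial bound for ONE Shimura degree per curve gives
`Summit.ABC.PolySzpiroRatEff (7K + 101) (7C + 145)`**, i.e. `log|Δ_min(E)| ≤ (7K + 101)·log N_E + 7C + 145` for ALL
elliptic `E/ℚ` — Pasten 2024 §1.4 "such a bound would imply Szpiro's conjecture!" / Thm 7.6, in kernel form at rung A-PS with
every constant explicit. Hypothesis `h` = the door's body with constants `(K, C)`: every `E` (any model) has an admissible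
`(D, M)`, a Shimura curve datum `X` and a datum `P` realising `δ_{D,M}(E)` with `log P.deg ≤ K log N_E + C`. Facts: `h61`
(refined Ribet–Takahashi, Thm 6.1), `hmod` (modularity), `h163` (Mazur–Kenku); NO Tamagawa / `∏ v_p` hypothesis. Proof:
pass to a global minimal model `C₁ • W` (`N_E`, `|Δ_min|` are model invariants) and apply
`log_minimalDiscriminant_le_of_shimuraDegree_le`. EFFECTIVE: yes. «NOT abc — POLY-SZPIRO(7K + 101)».
[cite: PastenShimura2024, §1.4 p. 9 and Thm. 7.6 (§7.5 p. 27)] -/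
theorem polySzpiroRatEff_of_log_shimuraDegree_le
    (h61 : PastenShimura2024_thm_6_1) (hmod : nonempty_modularParametrizationData)
    (h163 : PastenShimura2024_minimalDegree_le_163_mul) {K C : ℝ}
    (h : ∀ (W : WeierstrassCurve ℚ) [W.IsElliptic],
      ∃ (D M : ℕ) (X : ShimuraCurveData D M) (W' : WeierstrassCurve ℚ) (_ : W'.IsElliptic)
        (P : ShimuraParametrizationData X W'),
        IsAdmissibleFactorization (W.conductorNorm ℤ) D M ∧ P.IsMinimalFor W ∧
          Real.log (P.deg : ℝ) ≤ K * Real.log (W.conductorNorm ℤ : ℝ) + C) :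
    Summit.ABC.PolySzpiroRatEff (7 * K + 101) (7 * C + 145) := by
  intro W _
  obtain ⟨C₁, hC₁⟩ := hasGlobalMinimalModel_rat_holds W
  haveI := hC₁
  obtain ⟨D, M, X, W', hW', P, hadm, hP, hdeg⟩ := h (C₁ • W)
  haveI := hW'
  have hN : (C₁ • W).conductorNorm ℤ = W.conductorNorm ℤ := conductorNorm_smul_rat W C₁
  have hΔ : (C₁ • W).minimalDiscriminantNorm ℤ = W.minimalDiscriminantNorm ℤ :=
    minimalDiscriminantNorm_smul_rat W C₁
  have hcore := (log_minimalDiscriminant_le_of_shimuraDegree_le h61 hmod h163 (C₁ • W) hadm X P hP hdeg).1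
  rw [hN, hΔ] at hcore
  linarith

/-- **EFFECTIVE GLUE (PROVED MODULO THREE NAMED FACTS): the same door gives the Height conjecture with explicit constants**,
`h_F(E) ≤ (7K/12 + 8.5)·log N_E + 7C/12 + 11` for ALL `E/ℚ` (Pasten Thm 7.6, second inequality
`h(E) < (1/2 + ε) log δ_{D,M}(E)`, made explicit; `h_F = WeierstrassCurve.faltingsHeight`, a model invariant).
[cite: PastenShimura2024, Thm. 7.6 (§7.5 p. 27)] -/
theorem faltingsHeight_le_of_log_shimuraDegree_le
    (h61 : PastenShimura2024_thm_6_1) (hmod : nonempty_modularParametrizationData)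
    (h163 : PastenShimura2024_minimalDegree_le_163_mul) {K C : ℝ}
    (h : ∀ (W : WeierstrassCurve ℚ) [W.IsElliptic],
      ∃ (D M : ℕ) (X : ShimuraCurveData D M) (W' : WeierstrassCurve ℚ) (_ : W'.IsElliptic)
        (P : ShimuraParametrizationData X W'),
        IsAdmissibleFactorization (W.conductorNorm ℤ) D M ∧ P.IsMinimalFor W ∧
          Real.log (P.deg : ℝ) ≤ K * Real.log (W.conductorNorm ℤ : ℝ) + C)
    (W : WeierstrassCurve ℚ) [W.IsElliptic] :
    W.faltingsHeight ≤ (7 * K / 12 + 17 / 2) * Real.log (W.conductorNorm ℤ : ℝ) + (7 * C / 12 + 11) := by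
  obtain ⟨C₁, hC₁⟩ := hasGlobalMinimalModel_rat_holds W
  haveI := hC₁
  obtain ⟨D, M, X, W', hW', P, hadm, hP, hdeg⟩ := h (C₁ • W)
  haveI := hW'
  have hN : (C₁ • W).conductorNorm ℤ = W.conductorNorm ℤ := conductorNorm_smul_rat W C₁
  have hcore := (log_minimalDiscriminant_le_of_shimuraDegree_le h61 hmod h163 (C₁ • W) hadm X P hP hdeg).2
  rw [hN, faltingsHeight_smul W C₁] at hcore
  linarith

/-! ## The doors' `∃ K C` sentences: Height conjecture and §GLUE LEDGER G-09 -/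

/-- **GLUE (PROVED MODULO THREE NAMED FACTS): `ShimuraDegreeConjecture ⟹ HeightConjecture`** (Pasten Thm 7.6, second
inequality; Murty–Pasten Conj. 1.3 / Pasten Conj. 3.1 as the conclusion), with `(K, C) ↦ (7K/12 + 17/2, 7C/12 + 11)`.
Hypotheses `h61` (refined Ribet–Takahashi), `hmod` (modularity), `h163` (Mazur–Kenku). So the Shimura door sits between
the `D = 1` door and the Height door: `ModularDegreeConjecture ⟹ ShimuraDegreeConjecture ⟹ HeightConjecture ⟹ A-PS`
(`shimuraDegreeConjecture_of_modularDegreeConjecture` below; `polySzpiroRat_of_heightConjecture`, typ-1 p548749).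
[cite: PastenShimura2024, Thm. 7.6 (§7.5 p. 27) and Conj. 3.1 (§3 p. 13)] -/
theorem heightConjecture_of_shimuraDegreeConjecture
    (h61 : PastenShimura2024_thm_6_1) (hmod : nonempty_modularParametrizationData)
    (h163 : PastenShimura2024_minimalDegree_le_163_mul) (h : ShimuraDegreeConjecture) :
    HeightConjecture := by
  obtain ⟨K, C, hKC⟩ := h
  exact ⟨7 * K / 12 + 17 / 2, 7 * C / 12 + 11, fun W _ =>
    faltingsHeight_le_of_log_shimuraDegree_le h61 hmod h163 hKC W⟩

/-- **§GLUE LEDGER G-09 (PROVED MODULO THREE NAMED FACTS): the Shimura-degree door ⟹ polynomial Szpiro over `ℚ`, BY NAME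
on the rung decl `Summit.ABC.PolySzpiroRat`** — Pasten 2024 §1.4 "bounding each `δ_{D,M}` polynomially on the conductor
`N` … such a bound would imply Szpiro's conjecture!", in kernel form at rung A-PS: a polynomial bound for ONE Shimura degree
`δ_{D,M}(E)` per curve gives `log|Δ_min(E)| ≤ (7K + 101)·log N_E + 7C + 145` for ALL `E/ℚ`
(`polySzpiroRatEff_of_log_shimuraDegree_le`). Hypotheses (displayed, none silent): `h61` = Pasten's refined
Ribet–Takahashi formula (Thm 6.1, `Literature.NumberTheory.Automorphic.PastenShimura2024_thm_6_1`), `hmod` = modularity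
with an integral Manin constant (Wiles–BCDT + Edixhoven), `h163` = Mazur–Kenku; (EqHDeg), (EqDiscH), (EqUpperRT)-from-`h61`
and the `∏ v_p` bootstrap are tree-PROVED — NO Tamagawa hypothesis. «NOT abc — POLY-SZPIRO(7K + 101)»; PROVED-MOD-FACTS ≠
proved; no converse is known in print (A-PS ⟹ Height open). [cite: PastenShimura2024, §1.4 p. 9, Thm. 1.7 = Thm. 7.6, Thm. 6.1] -/
theorem polySzpiroRat_of_shimuraDegreeConjecture
    (h61 : PastenShimura2024_thm_6_1) (hmod : nonempty_modularParametrizationData)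
    (h163 : PastenShimura2024_minimalDegree_le_163_mul) (h : ShimuraDegreeConjecture) :
    Summit.ABC.PolySzpiroRat := by
  obtain ⟨K, C, hKC⟩ := h
  exact ⟨7 * K + 101, 7 * C + 145, polySzpiroRatEff_of_log_shimuraDegree_le h61 hmod h163 hKC⟩

/-! ## The `D = 1` door is an instance: `ModularDegreeConjecture ⟹ ShimuraDegreeConjecture` -/

/-- `IsMinimalFor` only depends on the `ℚ`-isomorphism class of the target curve: a datum realising `δ_{D,M}(C • W)`
realises `δ_{D,M}(W)` (`W ∼ C • W ∼ W`: tree `isIsogenous_smul`, `isIsogenous_of_smul`, `IsIsogenous.trans'`). [folklore] -/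
theorem isMinimalFor_of_smul {D M : ℕ} {X : ShimuraCurveData D M} {W W' : WeierstrassCurve ℚ}
    {P : ShimuraParametrizationData X W'} (C : WeierstrassCurve.VariableChange ℚ)
    (h : P.IsMinimalFor (C • W)) : P.IsMinimalFor W :=
  ⟨(WeierstrassCurve.isIsogenous_smul W C).trans' h.1, fun W'' _ P'' hiso =>
    h.2 W'' P'' ((WeierstrassCurve.isIsogenous_of_smul W C).trans' hiso)⟩

/-- **The `D = 1` door is the `(1, N)`-instance of the Shimura door: `ModularDegreeConjecture ⟹ ShimuraDegreeConjecture`,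
PROVED MODULO modularity only** (`hmod`), constants `(K, C)` unchanged — Pasten §2 p. 12 "We will write
`X₀^1(N) = X₀(N)`": for every `E/ℚ` (global minimal model `C₁ • W`, conductor `N`) the pair `(1, N)` is admissible
(`isAdmissibleFactorization_one`), a Shimura curve datum `X` of level `(1, N)` EXISTS as a THEOREM
(`nonempty_shimuraCurveData_holds`, Vignéras), the classical datum of `C₁ • W` (`hmod`) transports to `X` with its degree
(`exists_shimuraParametrizationData_deg_eq_modularDegree`, the tree's split-case transport), so a class-minimal Shimura
datum `P` exists (`ShimuraParametrizationData.exists_isMinimalFor_of_nonempty`) and `P.deg ≤ δ_{1,N}` = the degree of the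
class-minimal CLASSICAL datum `D₀` (`IsMinimalFor.deg_le_modularDegree`, Faltings' isogeny theorem being a theorem of the
tree) — at which `ModularDegreeConjecture` applies, its conductor guard met by strong multiplicity one
(`IsNewformOf.level_eq_conductorNorm_of_exists_conductorLevel`, as in `GlueModular.lean`). Hence the chain
`ModularDegreeConjecture ⟹ ShimuraDegreeConjecture ⟹ A-PS` re-derives G-07∘G-06 through G-09 (with the weaker constants
`7K + 101`): the Shimura door is AT MOST as hard as Conj. 3.2, as Pasten intends (§1.3 p. 6: "`X₀^D(M)` usually has genus
smaller than that of `X₀(N)`, which can be expected to lead to bounds for `δ_{D,M}` of better quality").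
[cite: PastenShimura2024, §2 p. 12 (X₀^1(N) = X₀(N), δ_{1,N}) and §1.3 p. 6] -/
theorem shimuraDegreeConjecture_of_modularDegreeConjecture (hmod : nonempty_modularParametrizationData)
    (h : ModularDegreeConjecture) : ShimuraDegreeConjecture := by
  obtain ⟨K, C, hKC⟩ := h
  refine ⟨K, C, fun W _ => ?_⟩
  -- a global minimal model, a datum of it, a class-minimal datum with the same newform
  obtain ⟨C₁, hC₁⟩ := hasGlobalMinimalModel_rat_holds W
  haveI := hC₁
  haveI : NeZero ((C₁ • W).conductorNorm ℤ) := ⟨(conductorNorm_pos_holds (C₁ • W)).ne'⟩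
  have hN : (C₁ • W).conductorNorm ℤ = W.conductorNorm ℤ := conductorNorm_smul_rat W C₁
  obtain ⟨D'⟩ := hmod (C₁ • W)
  obtain ⟨W₀, _, D₀, hf, hmin⟩ := Pasten2024.exists_minimal_datum_in_class D'
  have hnew : IsNewformOf (C₁ • W) D₀.f := by rw [hf]; exact D'.isNewformOf
  -- the conductor guard at `(W₀, D₀)`: the level `N_{C₁ • W}` is the conductor of `W₀`
  haveI : NeZero (W₀.conductorNorm ℤ) := ⟨(conductorNorm_pos_holds W₀).ne'⟩
  obtain ⟨C₀, hC₀⟩ := hasGlobalMinimalModel_rat_holds W₀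
  haveI := hC₀
  haveI : NeZero ((C₀ • W₀).conductorNorm ℤ) := ⟨(conductorNorm_pos_holds (C₀ • W₀)).ne'⟩
  obtain ⟨D''⟩ := hmod (C₀ • W₀)
  have hW₀ : ∃ g : CuspForm (CongruenceSubgroup.Gamma0 (W₀.conductorNorm ℤ)) 2, IsNewformOf W₀ g :=
    exists_isNewformOf_of_level_eq (conductorNorm_smul_rat W₀ C₀)
      ⟨D''.f, IsNewformOf.of_smul C₀ D''.isNewformOf⟩
  have hlev : (C₁ • W).conductorNorm ℤ = W₀.conductorNorm ℤ :=
    IsNewformOf.level_eq_conductorNorm_of_exists_conductorLevel hW₀ D₀.isNewformOf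
  have hdeg₀ : Real.log (D₀.modularDegree : ℝ) ≤ K * Real.log ((C₁ • W).conductorNorm ℤ : ℝ) + C :=
    hKC W₀ _ D₀ hlev.symm hmin
  -- a Shimura curve datum of level `(1, N)` (a theorem) and a class-minimal datum on it
  have hadm : IsAdmissibleFactorization ((C₁ • W).conductorNorm ℤ) 1 ((C₁ • W).conductorNorm ℤ) :=
    isAdmissibleFactorization_one (conductorNorm_pos_holds _)
  obtain ⟨X⟩ := nonempty_shimuraCurveData_holds hadm
  obtain ⟨P₁, -⟩ := exists_shimuraParametrizationData_deg_eq_modularDegree X D'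
  obtain ⟨W', hW', P, hP⟩ := ShimuraParametrizationData.exists_isMinimalFor_of_nonempty ⟨P₁⟩
  haveI := hW'
  have hPdeg : P.deg ≤ D₀.modularDegree := hP.deg_le_modularDegree D₀ hnew
  have hPpos : (0 : ℝ) < P.deg := by exact_mod_cast P.deg_pos
  have hlogP : Real.log (P.deg : ℝ) ≤ Real.log (D₀.modularDegree : ℝ) :=
    Real.log_le_log hPpos (by exact_mod_cast hPdeg)
  refine ⟨1, (C₁ • W).conductorNorm ℤ, X, W', hW', P, ?_, isMinimalFor_of_smul C₁ hP, ?_⟩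
  · exact ⟨conductorNorm_pos_holds W, by rw [one_mul, hN], squarefree_one, by simp,
      Nat.coprime_one_left _⟩
  · have hlogN : Real.log (((C₁ • W).conductorNorm ℤ : ℕ) : ℝ) = Real.log ((W.conductorNorm ℤ : ℕ) : ℝ) := by
      rw [hN]
    rw [hlogN] at hdeg₀
    exact hlogP.trans hdeg₀

end Summit.ABC.Harvest

end
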